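import Mathlib
import HarnessLib
import Literature.MathematicalPhysics.KineticTheory.HardSphereEulerProofs
import Literature.MathematicalPhysics.KineticTheory.HardSphereBBGKYLiouvilleFlow
import Literature.MathematicalPhysics.KineticTheory.HardSphereTwoTimePressure
import Literature.Analysis.FluidPDE.HardSphereTrajectoryMeasurable
import Literature.Analysis.FluidPDE.HardSphereTorusMeasure
import Summits.AtomisticToContinuum.HydrodynamicLimit.Theses.OneFlightGossipEngine

/-!
# A priori (β-linear) form of `KineticCurrentsWindowLD`: the window pressure is finite

Route `OneFlightGossipEngine`, items stmt-AtomisticToContinuum-9530 (`KineticCurrentsWindowLD`) and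
stmt-AtomisticToContinuum-14662 (`KineticCurrentsWindowLDUniform`): for `|F(x,v)| ≤ C(1+‖v‖²)`,
window `w_N = τ(N+1)^{-1/3}` and local Gibbs law `λ^N` they ask
`∫ exp(β ∑ᵢ w_N⁻¹∫₀^{w_N} F(xᵢ(r),vᵢ(r)) dr) dλ^N ≤ exp(ε(N+1))` for EVERY `ε > 0` (`τ ≥ τ(ε)`, `N ≥ N₀`).
Proved here (statics only): `abs_sum_window_integral_le` (along a good orbit the exponent is
`≤ C·n + 2C·E(z)`: time-measurability of the orbit + energy conservation);
`lintegral_exp_mul_configEnergy_localGibbsLaw_le` (`∫ e^{γE} dλ^N ≤ (e^{γU²}(1-2γΘ)^{-3/2})^{N+1}`: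
disintegration of `λ^N` into positions and independent Gaussian velocities, exact Gaussian moment
`∫ e^{s‖v-u‖²} dN(u,θ) = (1-2sθ)^{-3/2}`); `kineticCurrentsWindowLD_apriori`: for
`|β| ≤ 1/(8 max(C,1) sup θ₀)` some `c = c(β)` gives `≤ exp(c(N+1))` for EVERY `τ > 0` and EVERY `N`.
The items' content is exactly the improvement `c(β) ↦ ε` arbitrary as `τ → ∞` (open, dynamical).

References: Olla–Varadhan–Yau, Comm. Math. Phys. 155 (1993) 523, §2; Spohn, *Large Scale Dynamics of
Interacting Particles* (1991), Part I §2.3.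
-/

noncomputable section

open MeasureTheory Real
open scoped ENNReal

namespace Summit.AtomisticToContinuum.HydrodynamicLimit.Theorems

open Literature.Analysis.FluidPDE Literature.MathematicalPhysics.KineticTheory

/-! ### Gaussian exponential moments -/

section Gauss

variable {E : Type*} [NormedAddCommGroup E] [InnerProductSpace ℝ E] [FiniteDimensional ℝ E]
  [MeasurableSpace E] [BorelSpace E]

omit [MeasurableSpace E] [BorelSpace E] [FiniteDimensional ℝ E] in
/-- Tilting a Maxwellian by `exp(s‖v-u‖²)` with `2sθ < 1` gives the Maxwellian at the hotter
temperature `θ' = θ/(1-2sθ)`, times the ratio of normalisations `(θ'/θ)^{d/2}`. [folklore] -/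
theorem exp_mul_localMaxwellian_eq {θ s : ℝ} (hθ : 0 < θ) (hs : 2 * s * θ < 1) (u v : E) :
    Real.exp (s * ‖v - u‖ ^ 2) * localMaxwellian 1 θ u v =
      (1 - 2 * s * θ) ^ (-(Module.finrank ℝ E : ℝ) / 2) *
        localMaxwellian 1 (θ / (1 - 2 * s * θ)) u v := by
  have hk : 0 < 1 - 2 * s * θ := by linarith
  set d : ℝ := (Module.finrank ℝ E : ℝ)
  simp only [localMaxwellian, one_mul]
  have h1 : (2 * π * (θ / (1 - 2 * s * θ))) ^ (-d / 2) =
      (1 - 2 * s * θ) ^ (d / 2) * (2 * π * θ) ^ (-d / 2) := by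
    rw [show 2 * π * (θ / (1 - 2 * s * θ)) = (2 * π * θ) * (1 - 2 * s * θ)⁻¹ by ring,
      Real.mul_rpow (by positivity) (inv_nonneg.2 hk.le), Real.inv_rpow hk.le,
      ← Real.rpow_neg hk.le]
    ring_nf
  have h2 : Real.exp (s * ‖v - u‖ ^ 2) * Real.exp (-‖v - u‖ ^ 2 / (2 * θ)) =
      Real.exp (-‖v - u‖ ^ 2 / (2 * (θ / (1 - 2 * s * θ)))) := by
    rw [← Real.exp_add]
    congr 1
    field_simp
    ring
  have hc : (1 - 2 * s * θ) ^ (-d / 2) * (1 - 2 * s * θ) ^ (d / 2) = 1 := by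
    rw [← Real.rpow_add hk, show -d / 2 + d / 2 = 0 by ring, Real.rpow_zero]
  rw [h1, ← h2]
  linear_combination (-((2 * π * θ) ^ (-d / 2) * Real.exp (s * ‖v - u‖ ^ 2) *
    Real.exp (-‖v - u‖ ^ 2 / (2 * θ)))) * hc

/-- **Gaussian exponential moment of the squared fluctuation.** For `θ > 0` and `2sθ < 1`,
`∫ exp(s‖v-u‖²) dN(u, θ) = (1 - 2sθ)^{-d/2}` (stated as a `lintegral`). [folklore] -/
theorem lintegral_exp_mul_norm_sub_sq_gaussMeasure {θ s : ℝ} (hθ : 0 < θ) (hs : 2 * s * θ < 1)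
    (u : E) :
    ∫⁻ v, ENNReal.ofReal (Real.exp (s * ‖v - u‖ ^ 2)) ∂gaussMeasure u θ =
      ENNReal.ofReal ((1 - 2 * s * θ) ^ (-(Module.finrank ℝ E : ℝ) / 2)) := by
  have hk : 0 < 1 - 2 * s * θ := by linarith
  have hθ' : 0 < θ / (1 - 2 * s * θ) := div_pos hθ hk
  rw [← withDensity_localMaxwellian_eq_gaussMeasure hθ u,
    lintegral_withDensity_eq_lintegral_mul _
      (continuous_localMaxwellian 1 θ u).measurable.ennreal_ofReal
      (by fun_prop : Measurable fun v => ENNReal.ofReal (Real.exp (s * ‖v - u‖ ^ 2)))]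
  simp only [Pi.mul_apply]
  have hpt : ∀ v, ENNReal.ofReal (localMaxwellian 1 θ u v) *
      ENNReal.ofReal (Real.exp (s * ‖v - u‖ ^ 2)) =
      ENNReal.ofReal ((1 - 2 * s * θ) ^ (-(Module.finrank ℝ E : ℝ) / 2)) *
        ENNReal.ofReal (localMaxwellian 1 (θ / (1 - 2 * s * θ)) u v) := by
    intro v
    rw [← ENNReal.ofReal_mul (localMaxwellian_nonneg zero_le_one hθ.le u v), mul_comm,
      exp_mul_localMaxwellian_eq hθ hs u v,
      ENNReal.ofReal_mul (Real.rpow_nonneg hk.le _)]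
  simp_rw [hpt]
  rw [lintegral_const_mul _ (continuous_localMaxwellian 1 _ u).measurable.ennreal_ofReal,
    ← ofReal_integral_eq_lintegral_ofReal (integrable_localMaxwellian hθ' u)
      (Filter.Eventually.of_forall fun v => localMaxwellian_nonneg zero_le_one hθ'.le u v),
    integral_localMaxwellian_one hθ' u, ENNReal.ofReal_one, mul_one]

/-- **Gaussian exponential moment of the kinetic energy, crude form.** For `0 ≤ γ`, `θ > 0` with
`2γθ < 1`: `∫ exp(γ‖v‖²/2) dN(u,θ) ≤ exp(γ‖u‖²) (1-2γθ)^{-d/2}`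
(from `‖v‖² ≤ 2‖v-u‖² + 2‖u‖²`). [folklore] -/
theorem lintegral_exp_mul_norm_sq_gaussMeasure_le {θ γ : ℝ} (hθ : 0 < θ) (hγ : 0 ≤ γ)
    (hs : 2 * γ * θ < 1) (u : E) :
    ∫⁻ v, ENNReal.ofReal (Real.exp (γ * (‖v‖ ^ 2 / 2))) ∂gaussMeasure u θ ≤
      ENNReal.ofReal (Real.exp (γ * ‖u‖ ^ 2) *
        (1 - 2 * γ * θ) ^ (-(Module.finrank ℝ E : ℝ) / 2)) := by
  have hpt : ∀ v : E, Real.exp (γ * (‖v‖ ^ 2 / 2)) ≤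
      Real.exp (γ * ‖u‖ ^ 2) * Real.exp (γ * ‖v - u‖ ^ 2) := by
    intro v
    rw [← Real.exp_add]
    refine Real.exp_le_exp.2 ?_
    have h1 : ‖v‖ ≤ ‖v - u‖ + ‖u‖ := by simpa using norm_add_le (v - u) u
    have h2 : ‖v‖ ^ 2 ≤ (‖v - u‖ + ‖u‖) ^ 2 := pow_le_pow_left₀ (norm_nonneg v) h1 2
    nlinarith [h2, sq_nonneg (‖v - u‖ - ‖u‖)]
  calc ∫⁻ v, ENNReal.ofReal (Real.exp (γ * (‖v‖ ^ 2 / 2))) ∂gaussMeasure u θ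
      ≤ ∫⁻ v, ENNReal.ofReal (Real.exp (γ * ‖u‖ ^ 2)) *
          ENNReal.ofReal (Real.exp (γ * ‖v - u‖ ^ 2)) ∂gaussMeasure u θ := by
        refine lintegral_mono fun v => ?_
        rw [← ENNReal.ofReal_mul (Real.exp_nonneg _)]
        exact ENNReal.ofReal_le_ofReal (hpt v)
    _ = ENNReal.ofReal (Real.exp (γ * ‖u‖ ^ 2)) *
          ENNReal.ofReal ((1 - 2 * γ * θ) ^ (-(Module.finrank ℝ E : ℝ) / 2)) := by
        rw [lintegral_const_mul' _ _ ENNReal.ofReal_ne_top,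
          lintegral_exp_mul_norm_sub_sq_gaussMeasure hθ hs u]
    _ = _ := (ENNReal.ofReal_mul (Real.exp_nonneg _)).symm

end Gauss

/-! ### Exponential moments of the kinetic energy under a local Gibbs law -/

/-- Monotonicity of the one-particle constant `exp(γ‖u‖²)(1-2γθ)^{-d/2}` in `(‖u‖, θ)`.
[folklore] -/
theorem gaussMgfConst_mono {γ θ Θ r U d : ℝ} (hγ : 0 ≤ γ) (hd : 0 ≤ d) (hθ : θ ≤ Θ)
    (hΘ : 2 * γ * Θ < 1) (hr : 0 ≤ r) (hrU : r ≤ U) :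
    Real.exp (γ * r ^ 2) * (1 - 2 * γ * θ) ^ (-d / 2) ≤
      Real.exp (γ * U ^ 2) * (1 - 2 * γ * Θ) ^ (-d / 2) := by
  have hk : 0 < 1 - 2 * γ * Θ := by linarith
  refine mul_le_mul ?_ ?_ (Real.rpow_nonneg (by nlinarith) _) (Real.exp_nonneg _)
  · exact Real.exp_le_exp.2 (mul_le_mul_of_nonneg_left (pow_le_pow_left₀ hr hrU 2) hγ)
  · exact Real.rpow_le_rpow_of_nonpos hk (by nlinarith) (by linarith)

/-- **Exponential moments of the kinetic energy under a local Gibbs law are at most geometric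
in `N`.** For continuous `a₀, θ₀ > 0`, `u₀` with `θ₀ ≤ Θ`, `‖u₀‖ ≤ U`, `σ ≤ 1/2`, `0 ≤ γ`, `2γΘ < 1`:
`∫ exp(γ E(z)) dλ^N(z) ≤ (exp(γU²)(1-2γΘ)^{-3/2})^{N+1}` (conditionally on the positions the
velocities are independent Gaussians `N(u₀(xᵢ), θ₀(xᵢ))`). [folklore] -/
theorem lintegral_exp_mul_configEnergy_localGibbsLaw_le {a₀ θ₀ : T3 → ℝ} {u₀ : T3 → V3}
    (ha : Continuous a₀) (hθ : Continuous θ₀) (hu : Continuous u₀) (ha0 : ∀ x, 0 < a₀ x)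
    (hθ0 : ∀ x, 0 < θ₀ x) {σ : ℝ} (hσ2 : σ ≤ 1 / 2) (N : ℕ)
    (Φ : HardSphereFlow (Torus.geometry (Fin 3)) (hsDiameter σ N) (N + 1))
    {γ Θ U : ℝ} (hγ : 0 ≤ γ) (hΘ : ∀ x, θ₀ x ≤ Θ) (hU : ∀ x, ‖u₀ x‖ ≤ U)
    (hγΘ : 2 * γ * Θ < 1) :
    ∫⁻ z, ENNReal.ofReal (Real.exp (γ * configEnergy z)) ∂(localGibbsLaw σ a₀ u₀ θ₀ N Φ) ≤
      ENNReal.ofReal ((Real.exp (γ * U ^ 2) * (1 - 2 * γ * Θ) ^ (-(3 : ℝ) / 2)) ^ (N + 1)) := by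
  haveI := isProbabilityMeasure_localGibbsMeasure ha hθ hu ha0 hθ0 hσ2 N
  set K : ℝ := Real.exp (γ * U ^ 2) * (1 - 2 * γ * Θ) ^ (-(3 : ℝ) / 2) with hK
  have hK0 : 0 ≤ K := mul_nonneg (Real.exp_nonneg _) (Real.rpow_nonneg (by nlinarith [hΘ 0, hθ0 0]) _)
  set G : Config (N + 1) (Fin 3) T3 → ℝ≥0∞ := fun z => ENNReal.ofReal (Real.exp (γ * configEnergy z))
    with hG
  have hEm : Measurable fun z : Config (N + 1) (Fin 3) T3 => configEnergy z := by
    unfold configEnergy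
    exact measurable_const.mul (Finset.measurable_sum _ fun i _ =>
      ((measurable_pi_apply i).snd.norm.pow_const 2))
  have hGm : Measurable G := (Real.measurable_exp.comp (measurable_const.mul hEm)).ennreal_ofReal
  -- the velocity integral given the positions factorises into one-particle Gaussian moments
  have hfac : ∀ (x : Fin (N + 1) → T3) (v : Fin (N + 1) → V3),
      G (zipConfig (x, v)) = ∏ i, ENNReal.ofReal (Real.exp (γ * (‖v i‖ ^ 2 / 2))) := by
    intro x v
    simp only [hG, configEnergy, zipConfig_apply]
    rw [Finset.mul_sum, Finset.mul_sum, Real.exp_sum, ENNReal.ofReal_prod_of_nonneg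
      (fun i _ => Real.exp_nonneg _)]
    refine Finset.prod_congr rfl fun i _ => ?_
    congr 2
    ring
  have hvel : ∀ x : Fin (N + 1) → T3,
      ∫⁻ v, G (zipConfig (x, v)) ∂velMeasure u₀ θ₀ x ≤ ENNReal.ofReal (K ^ (N + 1)) := by
    intro x
    simp_rw [hfac x]
    rw [velMeasure, lintegral_fintype_prod_eq_prod' _ (fun i =>
      (by fun_prop : Measurable fun w : V3 => ENNReal.ofReal (Real.exp (γ * (‖w‖ ^ 2 / 2)))))]
    calc ∏ i, ∫⁻ w, ENNReal.ofReal (Real.exp (γ * (‖w‖ ^ 2 / 2))) ∂gaussMeasure (u₀ (x i)) (θ₀ (x i))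
        ≤ ∏ _i : Fin (N + 1), ENNReal.ofReal K := by
          refine Finset.prod_le_prod' fun i _ => ?_
          have h2 : 2 * γ * θ₀ (x i) < 1 := by nlinarith [hΘ (x i)]
          refine (lintegral_exp_mul_norm_sq_gaussMeasure_le (hθ0 (x i)) hγ h2 (u₀ (x i))).trans ?_
          refine ENNReal.ofReal_le_ofReal ?_
          have h := gaussMgfConst_mono (d := 3) hγ (by norm_num) (hΘ (x i)) hγΘ (norm_nonneg _)
            (hU (x i))
          simpa [finrank_euclideanSpace_fin] using h
      _ = ENNReal.ofReal (K ^ (N + 1)) := by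
          rw [Finset.prod_const, Finset.card_univ, Fintype.card_fin, ENNReal.ofReal_pow hK0]
  rw [localGibbsLaw_eq, lintegral_localGibbsMeasure ha hθ hu (fun x => (ha0 x).le) hθ0 σ N hGm]
  calc ∫⁻ x, ENNReal.ofReal ((canonicalPartition (Torus.geometry (Fin 3)) (hsDiameter σ N) (N + 1)
          (localGibbsProfile a₀ u₀ θ₀))⁻¹ * posWeight a₀ (hsDiameter σ N) (N + 1) x) *
          ∫⁻ v, G (zipConfig (x, v)) ∂velMeasure u₀ θ₀ x
      ≤ ∫⁻ x, ENNReal.ofReal ((canonicalPartition (Torus.geometry (Fin 3)) (hsDiameter σ N) (N + 1)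
          (localGibbsProfile a₀ u₀ θ₀))⁻¹ * posWeight a₀ (hsDiameter σ N) (N + 1) x) *
          ENNReal.ofReal (K ^ (N + 1)) :=
        lintegral_mono fun x => mul_le_mul_right (hvel x) _
    _ = ENNReal.ofReal (K ^ (N + 1)) := by
        have hρm : Measurable fun x : Fin (N + 1) → T3 => ENNReal.ofReal
            ((canonicalPartition (Torus.geometry (Fin 3)) (hsDiameter σ N) (N + 1)
              (localGibbsProfile a₀ u₀ θ₀))⁻¹ * posWeight a₀ (hsDiameter σ N) (N + 1) x) :=
          (measurable_const.mul (measurable_posWeight ha _ _)).ennreal_ofReal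
        rw [lintegral_mul_const _ hρm,
          lintegral_posWeight_eq_one ha hθ hu (fun x => (ha0 x).le) hθ0 σ N, one_mul]

/-! ### The exponent along a good orbit -/

/-- Twice the kinetic energy is the sum of the squared speeds. [folklore] -/
theorem sum_norm_vel_sq_eq_two_mul_configEnergy {n : ℕ} (z : Config n (Fin 3) T3) :
    ∑ i, ‖(z i).2‖ ^ 2 = 2 * configEnergy z := by
  unfold configEnergy
  ring

/-- **Window integrals of the squared speeds along a good orbit**: each `r ↦ ‖vᵢ(r)‖²` is interval
integrable (bounded measurable step function) and `∑ᵢ ∫₀ʷ ‖vᵢ(r)‖² dr = 2E(z)·w`. [folklore] -/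
theorem sum_window_integral_norm_sq_eq {ε : ℝ} {n : ℕ}
    (Φ : HardSphereFlow (Torus.geometry (Fin 3)) ε n) {z : Config n (Fin 3) T3}
    (hz : z ∈ Φ.good) (w : ℝ) :
    (∀ i, IntervalIntegrable (fun r => ‖(Φ.flow r z i).2‖ ^ 2) volume 0 w) ∧
      ∑ i, ∫ r in (0 : ℝ)..w, ‖(Φ.flow r z i).2‖ ^ 2 = 2 * configEnergy z * w := by
  have hγ : Measurable fun t => Φ.flow t z := (Φ.isTrajectory z hz).measurable_torus
  have hv : ∀ i, Measurable fun r => ‖(Φ.flow r z i).2‖ ^ 2 := fun i =>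
    ((measurable_pi_apply i).comp hγ).snd.norm.pow_const 2
  have hE : ∀ i r, ‖(Φ.flow r z i).2‖ ^ 2 ≤ 2 * configEnergy z := fun i r =>
    (norm_vel_sq_le_two_mul_configEnergy _ i).trans_eq (by rw [Φ.configEnergy_flow hz r])
  have hvint : ∀ i, IntervalIntegrable (fun r => ‖(Φ.flow r z i).2‖ ^ 2) volume 0 w := fun i =>
    (intervalIntegrable_const (c := 2 * configEnergy z)).mono_fun' (hv i).aestronglyMeasurable
      (ae_of_all _ fun r => by simpa only [Real.norm_eq_abs, abs_pow, abs_norm] using hE i r)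
  refine ⟨hvint, ?_⟩
  rw [← intervalIntegral.integral_finsetSum fun i _ => hvint i]
  have : (fun r => ∑ i, ‖(Φ.flow r z i).2‖ ^ 2) = fun _ => 2 * configEnergy z := by
    funext r
    rw [sum_norm_vel_sq_eq_two_mul_configEnergy, Φ.configEnergy_flow hz r]
  rw [this, intervalIntegral.integral_const, sub_zero, smul_eq_mul]
  ring

/-- **Energy bound of the window functional along a good orbit**: for `|F(x,v)| ≤ C(1+‖v‖²)`
and `w > 0`, `|∑ᵢ w⁻¹ ∫₀ʷ F(Φ_r z i) dr| ≤ C·n + 2C·E(z)` (the orbit is measurable in time,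
`IsHardSphereTrajectory.measurable_torus`, and `∑ᵢ ‖vᵢ(r)‖² = 2E(z)` by
`HardSphereFlow.configEnergy_flow`). [folklore] -/
theorem abs_sum_window_integral_le {ε : ℝ} {n : ℕ}
    (Φ : HardSphereFlow (Torus.geometry (Fin 3)) ε n) {z : Config n (Fin 3) T3}
    (hz : z ∈ Φ.good) {F : T3 × V3 → ℝ} {C : ℝ} (hC : ∀ y, |F y| ≤ C * (1 + ‖y.2‖ ^ 2))
    {w : ℝ} (hw : 0 < w) :
    |∑ i, w⁻¹ * ∫ r in (0 : ℝ)..w, F (Φ.flow r z i)| ≤ C * n + 2 * C * configEnergy z := by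
  obtain ⟨hvint, hsum⟩ := sum_window_integral_norm_sq_eq Φ hz w
  have hgint : ∀ i, IntervalIntegrable (fun r => C * (1 + ‖(Φ.flow r z i).2‖ ^ 2)) volume 0 w :=
    fun i => ((intervalIntegrable_const (c := (1 : ℝ))).add (hvint i)).const_mul C
  have hFi : ∀ i, |∫ r in (0 : ℝ)..w, F (Φ.flow r z i)| ≤
      C * w + C * ∫ r in (0 : ℝ)..w, ‖(Φ.flow r z i).2‖ ^ 2 := by
    intro i
    have h := intervalIntegral.norm_integral_le_of_norm_le hw.le
      (ae_of_all _ fun r _ => (Real.norm_eq_abs _).trans_le (hC (Φ.flow r z i))) (hgint i)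
    rw [Real.norm_eq_abs] at h
    refine h.trans_eq ?_
    rw [intervalIntegral.integral_const_mul, intervalIntegral.integral_add
      (intervalIntegrable_const (c := (1 : ℝ))) (hvint i), intervalIntegral.integral_const]
    simp only [sub_zero, smul_eq_mul, mul_one]
    ring
  calc |∑ i, w⁻¹ * ∫ r in (0 : ℝ)..w, F (Φ.flow r z i)|
      ≤ ∑ i, |w⁻¹ * ∫ r in (0 : ℝ)..w, F (Φ.flow r z i)| := Finset.abs_sum_le_sum_abs _ _
    _ = ∑ i, w⁻¹ * |∫ r in (0 : ℝ)..w, F (Φ.flow r z i)| := by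
        refine Finset.sum_congr rfl fun i _ => ?_
        rw [abs_mul, abs_of_pos (inv_pos.2 hw)]
    _ ≤ ∑ i, w⁻¹ * (C * w + C * ∫ r in (0 : ℝ)..w, ‖(Φ.flow r z i).2‖ ^ 2) :=
        Finset.sum_le_sum fun i _ => mul_le_mul_of_nonneg_left (hFi i) (inv_pos.2 hw).le
    _ = C * n + C * w⁻¹ * ∑ i, ∫ r in (0 : ℝ)..w, ‖(Φ.flow r z i).2‖ ^ 2 := by
        rw [Finset.mul_sum]
        have : ∀ i ∈ Finset.univ, w⁻¹ * (C * w + C * ∫ r in (0 : ℝ)..w, ‖(Φ.flow r z i).2‖ ^ 2) =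
            C + C * w⁻¹ * ∫ r in (0 : ℝ)..w, ‖(Φ.flow r z i).2‖ ^ 2 := by
          intro i _
          field_simp
        rw [Finset.sum_congr rfl this, Finset.sum_add_distrib, Finset.sum_const, Finset.card_univ,
          Fintype.card_fin, nsmul_eq_mul]
        ring
    _ = C * n + 2 * C * configEnergy z := by
        rw [hsum]
        field_simp

/-- A quadratic growth constant is nonnegative (test at `(x,v) = 0`). [folklore] -/
theorem growthConst_nonneg {F : T3 × V3 → ℝ} {C : ℝ} (hC : ∀ y, |F y| ≤ C * (1 + ‖y.2‖ ^ 2)) :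
    0 ≤ C := by
  simpa using (abs_nonneg _).trans (hC 0)

/-- Pointwise exponential form of the energy bound: for a good orbit,
`exp(β ∑ᵢ w⁻¹∫₀ʷ F) ≤ exp(|β|C)^n · exp(2|β|C · E(z))`. [folklore] -/
theorem exp_window_sum_le {ε : ℝ} {n : ℕ}
    (Φ : HardSphereFlow (Torus.geometry (Fin 3)) ε n) {z : Config n (Fin 3) T3}
    (hz : z ∈ Φ.good) {F : T3 × V3 → ℝ} {C : ℝ} (hC : ∀ y, |F y| ≤ C * (1 + ‖y.2‖ ^ 2))
    {w : ℝ} (hw : 0 < w) (β : ℝ) :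
    Real.exp (β * ∑ i, w⁻¹ * ∫ r in (0 : ℝ)..w, F (Φ.flow r z i)) ≤
      Real.exp (|β| * C) ^ n * Real.exp (2 * |β| * C * configEnergy z) := by
  rw [← Real.exp_nat_mul, ← Real.exp_add]
  refine Real.exp_le_exp.2 ?_
  have h := abs_sum_window_integral_le Φ hz hC hw
  have hb : β * ∑ i, w⁻¹ * ∫ r in (0 : ℝ)..w, F (Φ.flow r z i) ≤
      |β| * (C * n + 2 * C * configEnergy z) :=
    (le_abs_self _).trans ((abs_mul β _).trans_le (mul_le_mul_of_nonneg_left h (abs_nonneg β)))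
  exact hb.trans_eq (by ring)

/-! ### The a priori bound in the shape of the item -/

/-- **One window, one `N`.** Under a local Gibbs law with `θ₀ ≤ Θ`, `‖u₀‖ ≤ U`, `σ ≤ 1/2`, for
`|F| ≤ C(1+‖v‖²)`, `w > 0` and `4|β|CΘ < 1`:
`∫ exp(β ∑ᵢ w⁻¹∫₀ʷ F(Φ_r z i) dr) dλ^N ≤ (e^{|β|C} e^{2|β|C U²} (1 - 4|β|CΘ)^{-3/2})^{N+1}`. [folklore] -/
theorem lintegral_exp_window_sum_le {a₀ θ₀ : T3 → ℝ} {u₀ : T3 → V3}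
    (ha : Continuous a₀) (hθ : Continuous θ₀) (hu : Continuous u₀) (ha0 : ∀ x, 0 < a₀ x)
    (hθ0 : ∀ x, 0 < θ₀ x) {σ : ℝ} (hσ2 : σ ≤ 1 / 2) (N : ℕ)
    (Φ : HardSphereFlow (Torus.geometry (Fin 3)) (hsDiameter σ N) (N + 1))
    {F : T3 × V3 → ℝ} {C : ℝ} (hC : ∀ y, |F y| ≤ C * (1 + ‖y.2‖ ^ 2))
    {Θ U : ℝ} (hΘ : ∀ x, θ₀ x ≤ Θ) (hU : ∀ x, ‖u₀ x‖ ≤ U)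
    {β : ℝ} (hβ : 4 * |β| * C * Θ < 1) {w : ℝ} (hw : 0 < w) :
    ∫⁻ z, ENNReal.ofReal (Real.exp (β * ∑ i, w⁻¹ * ∫ r in (0 : ℝ)..w, F (Φ.flow r z i)))
        ∂(localGibbsLaw σ a₀ u₀ θ₀ N Φ) ≤
      ENNReal.ofReal ((Real.exp (|β| * C) * (Real.exp (2 * |β| * C * U ^ 2) *
        (1 - 4 * |β| * C * Θ) ^ (-(3 : ℝ) / 2))) ^ (N + 1)) := by
  have hC0 : 0 ≤ C := growthConst_nonneg hC
  set γ : ℝ := 2 * |β| * C with hγdef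
  have hγ0 : 0 ≤ γ := by positivity
  have hγΘ : 2 * γ * Θ < 1 := by rw [hγdef]; linarith
  have hK0 : 0 ≤ Real.exp (|β| * C) ^ (N + 1) := pow_nonneg (Real.exp_nonneg _) _
  have hae : ∀ᵐ z ∂(localGibbsLaw σ a₀ u₀ θ₀ N Φ),
      ENNReal.ofReal (Real.exp (β * ∑ i, w⁻¹ * ∫ r in (0 : ℝ)..w, F (Φ.flow r z i))) ≤
        ENNReal.ofReal (Real.exp (|β| * C) ^ (N + 1)) *
          ENNReal.ofReal (Real.exp (γ * configEnergy z)) := by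
    filter_upwards [ae_mem_good_localGibbsLaw σ a₀ u₀ θ₀ N Φ] with z hz
    rw [← ENNReal.ofReal_mul hK0]
    refine ENNReal.ofReal_le_ofReal ?_
    have h := exp_window_sum_le Φ hz hC hw β
    rwa [hγdef]
  calc ∫⁻ z, ENNReal.ofReal (Real.exp (β * ∑ i, w⁻¹ * ∫ r in (0 : ℝ)..w, F (Φ.flow r z i)))
        ∂(localGibbsLaw σ a₀ u₀ θ₀ N Φ)
      ≤ ∫⁻ z, ENNReal.ofReal (Real.exp (|β| * C) ^ (N + 1)) *
          ENNReal.ofReal (Real.exp (γ * configEnergy z)) ∂(localGibbsLaw σ a₀ u₀ θ₀ N Φ) :=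
        lintegral_mono_ae hae
    _ = ENNReal.ofReal (Real.exp (|β| * C) ^ (N + 1)) *
          ∫⁻ z, ENNReal.ofReal (Real.exp (γ * configEnergy z)) ∂(localGibbsLaw σ a₀ u₀ θ₀ N Φ) :=
        lintegral_const_mul' _ _ ENNReal.ofReal_ne_top
    _ ≤ ENNReal.ofReal (Real.exp (|β| * C) ^ (N + 1)) *
          ENNReal.ofReal ((Real.exp (γ * U ^ 2) * (1 - 2 * γ * Θ) ^ (-(3 : ℝ) / 2)) ^ (N + 1)) :=
        mul_le_mul' le_rfl
          (lintegral_exp_mul_configEnergy_localGibbsLaw_le ha hθ hu ha0 hθ0 hσ2 N Φ hγ0 hΘ hU hγΘ)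
    _ = _ := by
        rw [← ENNReal.ofReal_mul hK0, ← mul_pow, hγdef]
        congr 3
        ring

/-- **A priori (β-linear) form of `KineticCurrentsWindowLD` / `KineticCurrentsWindowLDUniform`.**
For continuous `a, θ₀ > 0`, `u₀`, every `0 < σ ≤ 1/2`, every flow family and every observable with
`|F(x,v)| ≤ C(1+‖v‖²)` (in particular the items' class) there is `β₀ > 0` (`= 1/(8 max(C,1) sup θ₀)`)
such that for `|β| ≤ β₀` some `c = c(β)` bounds the window exponential moment by `exp(c(N+1))` for
EVERY `τ > 0` and EVERY `N`; the items ask for `c` arbitrarily small for `τ, N` large, which is their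
entire (open, dynamical) content. [folklore] -/
theorem kineticCurrentsWindowLD_apriori (a θ₀ : T3 → ℝ) (u₀ : T3 → V3) (ha : Continuous a)
    (hθ : Continuous θ₀) (hu : Continuous u₀) (ha0 : ∀ x, 0 < a x) (hθ0 : ∀ x, 0 < θ₀ x) :
    ∀ σ : ℝ, 0 < σ → σ ≤ 1 / 2 →
      ∀ Φ : (N : ℕ) → HardSphereFlow (Torus.geometry (Fin 3)) (hsDiameter σ N) (N + 1),
      ∀ (F : T3 × V3 → ℝ) (C : ℝ), (∀ y, |F y| ≤ C * (1 + ‖y.2‖ ^ 2)) →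
      ∃ β₀ : ℝ, 0 < β₀ ∧ ∀ β : ℝ, |β| ≤ β₀ → ∃ c : ℝ, ∀ τ : ℝ, 0 < τ → ∀ N : ℕ,
        ∫⁻ z, ENNReal.ofReal (Real.exp (β * ∑ i : Fin (N + 1),
            (τ * ((N : ℝ) + 1) ^ (-(1 / 3 : ℝ)))⁻¹ *
              ∫ r in (0 : ℝ)..(τ * ((N : ℝ) + 1) ^ (-(1 / 3 : ℝ))), F (((Φ N).flow r z) i)))
          ∂(localGibbsLaw σ a u₀ θ₀ N (Φ N)) ≤
        ENNReal.ofReal (Real.exp (c * ((N : ℝ) + 1))) := by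
  intro σ _hσ hσ2 Φ F C hC
  have hbθ : BddAbove (Set.range θ₀) := (isCompact_range hθ).bddAbove
  have hbu : BddAbove (Set.range fun x => ‖u₀ x‖) := (isCompact_range hu.norm).bddAbove
  set Θ : ℝ := ⨆ x, θ₀ x
  set U : ℝ := ⨆ x, ‖u₀ x‖
  have hΘ : ∀ x, θ₀ x ≤ Θ := fun x => le_ciSup hbθ x
  have hU : ∀ x, ‖u₀ x‖ ≤ U := fun x => le_ciSup hbu x
  have hΘ0 : 0 < Θ := (hθ0 0).trans_le (hΘ 0)
  have hC0 : 0 ≤ C := growthConst_nonneg hC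
  set C' : ℝ := max C 1
  have hC' : C ≤ C' := le_max_left _ _
  have hC'1 : 1 ≤ C' := le_max_right _ _
  refine ⟨1 / (8 * C' * Θ), by positivity, fun β hβ => ?_⟩
  have h4 : 4 * |β| * C * Θ < 1 := by
    have h1 : |β| * (8 * C' * Θ) ≤ 1 := by rwa [le_div_iff₀ (by positivity)] at hβ
    have h2 : 4 * |β| * C * Θ ≤ 4 * |β| * C' * Θ := by have := abs_nonneg β; gcongr
    nlinarith
  set K : ℝ := Real.exp (|β| * C) * (Real.exp (2 * |β| * C * U ^ 2) *
    (1 - 4 * |β| * C * Θ) ^ (-(3 : ℝ) / 2))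
  have hKpos : 0 < K := by
    have : 0 < 1 - 4 * |β| * C * Θ := by linarith
    positivity
  refine ⟨Real.log K, fun τ hτ N => ?_⟩
  have hw : 0 < τ * ((N : ℝ) + 1) ^ (-(1 / 3 : ℝ)) := mul_pos hτ (Real.rpow_pos_of_pos (by positivity) _)
  refine (lintegral_exp_window_sum_le ha hθ hu ha0 hθ0 hσ2 N (Φ N) hC hΘ hU h4 hw).trans_eq ?_
  congr 1
  rw [show (Real.log K * ((N : ℝ) + 1)) = ((N + 1 : ℕ) : ℝ) * Real.log K by push_cast; ring,
    Real.exp_nat_mul, Real.exp_log hKpos]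

end Summit.AtomisticToContinuum.HydrodynamicLimit.Theorems

end
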